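import Summits.CriticalPhenomena.PercolationContinuityZ3.Theorems.PercNearOneGluingNoHeavyPcintBSMXLaw
import Summits.CriticalPhenomena.PercolationContinuityZ3.Theorems.PercNearOneGluingNoHeavyPcintBSMGreen
import HarnessLib

/-!
# PCINT lane, PHASE 6 (block renewal with reach-two pieces), step 2: the product formula with five letters

Cell `prim-pcint`, seat `prim-pcint-1` (gen 15); memo `run/shared/lean/prim/pcint/T-FIBRE-ROUTE.md` §PHASE 6.

The PHASE-5 block machinery (…PcintBSMBlocks: pieces `pc : Fin np → List (Fin t × Bool)`, blocks, local shared
counts `Rloc`, pair sums `A`, transition sums `Pn`, partial Green sums `Gm`, the certificate bound `A_le_of_cert'`)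
is generic in the piece table.  Here the piece endpoints lie in the REACH-TWO cube `{-2,…,2}^t` (`BSMX.Cube2`) and
the weights `w` have the product endpoint marginal `Π_i g₅ a₁ a₂ (v i)` (`BSMX.Marg5`); then the transition sums of
the pair offset chain factorise (**`BSMX.Pn_eq5`**):

  `Pn pc ν n (τ, y) (τ', y') = cnt k n (τ - τ') / k^{2n} · Π_i H a₁ a₂ (2n) (y' i - y i)`

(time part = the tree's oriented pair counts `OSM.cnt`, transverse part = the `2n`-fold convolution of the five-point
law, …PcintBSMXLaw), whence the diagonal class of the partial Green sums (`BSMX.Gm_zero_eq5`) and the summed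
adjacent classes (`BSMX.sum_Gm_adj_eq5`) exactly as in …PcintBSMGreen.
-/

noncomputable section

namespace Summit.CriticalPhenomena.PercolationContinuityZ3.Theorems.Pcint.BSMX

open Finset OSM BSM

variable {t k np : ℕ}

/-! ### Coding the reach-two cube by letters -/

/-- The letter of an integer in `{-2,…,2}` (total: anything else is sent to `4`). -/
def code5 (x : ℤ) : Fin 5 := if x = -2 then 0 else if x = -1 then 1 else if x = 0 then 2 else if x = 1 then 3 else 4

/-- `val5 (code5 x) = x` on the cube. -/
theorem val5_code5 {x : ℤ} (hx : -2 ≤ x ∧ x ≤ 2) : val5 (code5 x) = x := by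
  unfold code5 val5
  have : x = -2 ∨ x = -1 ∨ x = 0 ∨ x = 1 ∨ x = 2 := by omega
  rcases this with h | h | h | h | h <;> subst h <;> simp

/-- `code5 (val5 c) = c`. -/
theorem code5_val5 (c : Fin 5) : code5 (val5 c) = c := by
  fin_cases c <;> rfl

/-- The letters of a piece endpoint. -/
def codev5 (pc : Fin np → List (Fin t × Bool)) (σ : Fin np) : Fin t → Fin 5 := fun i => code5 (pend (pc σ) i)

/-- **Reach-two cube hypothesis**: all piece endpoints lie in `{-2,…,2}^t`. -/
def Cube2 (pc : Fin np → List (Fin t × Bool)) : Prop :=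
  ∀ σ i, -2 ≤ pend (pc σ) i ∧ pend (pc σ) i ≤ 2

/-- **Marginal hypothesis**: the endpoint law of a `w`-random piece is the product law `Π_i g₅ a₁ a₂ (v i)`. -/
def Marg5 (pc : Fin np → List (Fin t × Bool)) (w : Fin np → ℝ) (a₁ a₂ : ℝ) : Prop :=
  ∀ v : Fin t → Fin 5, ∑ σ : Fin np, (if codev5 pc σ = v then w σ else 0) = ∏ i, g₅ a₁ a₂ (v i)

/-- Under the cube hypothesis the endpoint is read off its letters. -/
theorem pend_eq_val5_codev5 {pc : Fin np → List (Fin t × Bool)} (hc : Cube2 pc) (σ : Fin np) :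
    pend (pc σ) = fun i => val5 (codev5 pc σ i) := by
  funext i; exact (val5_code5 (hc σ i)).symm

/-- The piece weights sum to one under the marginal hypothesis. -/
theorem sum_w_of_marg5 {pc : Fin np → List (Fin t × Bool)} {w : Fin np → ℝ} {a₁ a₂ : ℝ} (hm : Marg5 pc w a₁ a₂) :
    ∑ σ, w σ = 1 := by
  have hm' : ∀ v : Fin t → Fin 5, ∑ σ : Fin np, (if codev5 pc σ = v then w σ else 0) = ∏ i, g₅ a₁ a₂ (v i) := hm
  have h1 : ∑ σ : Fin np, w σ = ∑ v : Fin t → Fin 5, ∑ σ : Fin np, if codev5 pc σ = v then w σ else 0 := by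
    rw [sum_comm]
    refine sum_congr rfl fun σ _ => ?_
    rw [sum_ite_eq]; simp
  rw [h1]
  simp_rw [hm']
  rw [← Fintype.prod_sum]
  simp [sum_g₅]

/-! ### The product formula -/

/-- The letter map of a pair of blocks: time axes and endpoint letters. -/
def Φ5 (pc : Fin np → List (Fin t × Bool)) (p : Blk np k × Blk np k) : (Fin k × Fin k) × (Fin t → Fin 5 × Fin 5) :=
  ((p.1.2, p.2.2), fun i => (codev5 pc p.1.1 i, codev5 pc p.2.1 i))

/-- The offset increment read off the letters. -/
def Dℓ5 (ℓ : (Fin k × Fin k) × (Fin t → Fin 5 × Fin 5)) : Off t k :=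
  (e ℓ.1.2 - e ℓ.1.1, fun i => val5 (ℓ.2 i).2 - val5 (ℓ.2 i).1)

/-- Under the cube hypothesis `δ = Dℓ5 ∘ Φ5`. -/
theorem δ_eq_Dℓ5 {pc : Fin np → List (Fin t × Bool)} (hc : Cube2 pc) (p : Blk np k × Blk np k) :
    δ pc p.1 p.2 = Dℓ5 (Φ5 pc p) := by
  unfold δ Dℓ5 Φ5
  simp only
  rw [pend_eq_val5_codev5 hc, pend_eq_val5_codev5 hc]
  rfl

/-- **The fibre weights of `Φ5`**: `Σ_{Φ5 p = ℓ} ν p.1 ν p.2 = (1/k²) Π_i g₅(ℓ.2 i).1 g₅(ℓ.2 i).2`. -/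
theorem fibre_Φ5 {pc : Fin np → List (Fin t × Bool)} {w : Fin np → ℝ} {a₁ a₂ : ℝ} (hm : Marg5 pc w a₁ a₂)
    (hk : 0 < k) (ℓ : (Fin k × Fin k) × (Fin t → Fin 5 × Fin 5)) :
    ∑ p : Blk np k × Blk np k, (if Φ5 pc p = ℓ then νw k w p.1 * νw k w p.2 else 0) =
      (1 : ℝ) / (k : ℝ) ^ 2 * ∏ i, (g₅ a₁ a₂ (ℓ.2 i).1 * g₅ a₁ a₂ (ℓ.2 i).2) := by
  have hk0 : (k : ℝ) ≠ 0 := by exact_mod_cast hk.ne'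
  have hm' : ∀ v : Fin t → Fin 5, ∑ σ : Fin np, (if codev5 pc σ = v then w σ else 0) = ∏ i, g₅ a₁ a₂ (v i) := hm
  set v₁ : Fin t → Fin 5 := fun i => (ℓ.2 i).1 with hv₁
  set v₂ : Fin t → Fin 5 := fun i => (ℓ.2 i).2 with hv₂
  -- the condition splits into four independent ones
  have hcond : ∀ p : Blk np k × Blk np k, (Φ5 pc p = ℓ) ↔
      ((p.1.2 = ℓ.1.1 ∧ codev5 pc p.1.1 = v₁) ∧ (p.2.2 = ℓ.1.2 ∧ codev5 pc p.2.1 = v₂)) := by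
    intro p
    unfold Φ5
    rw [Prod.ext_iff, Prod.ext_iff]
    simp only
    constructor
    · rintro ⟨⟨h1, h2⟩, h3⟩
      refine ⟨⟨h1, ?_⟩, h2, ?_⟩
      · funext i; exact congr_arg Prod.fst (congr_fun h3 i)
      · funext i; exact congr_arg Prod.snd (congr_fun h3 i)
    · rintro ⟨⟨h1, h3⟩, h2, h4⟩
      refine ⟨⟨h1, h2⟩, ?_⟩
      funext i; exact Prod.ext (congr_fun h3 i) (congr_fun h4 i)
  -- the two factors
  set F₁ : Blk np k → ℝ := fun b =>
    (if b.2 = ℓ.1.1 then (1 : ℝ) else 0) * (if codev5 pc b.1 = v₁ then w b.1 / k else 0) with hF₁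
  set F₂ : Blk np k → ℝ := fun b =>
    (if b.2 = ℓ.1.2 then (1 : ℝ) else 0) * (if codev5 pc b.1 = v₂ then w b.1 / k else 0) with hF₂
  -- termwise factorisation
  have hterm : ∀ p : Blk np k × Blk np k, (if Φ5 pc p = ℓ then νw k w p.1 * νw k w p.2 else 0) =
      F₁ p.1 * F₂ p.2 := by
    intro p
    rw [if_congr (hcond p) rfl rfl, hF₁, hF₂]
    unfold νw
    dsimp only
    by_cases h1 : p.1.2 = ℓ.1.1 <;> by_cases h2 : codev5 pc p.1.1 = v₁ <;> by_cases h3 : p.2.2 = ℓ.1.2 <;>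
      by_cases h4 : codev5 pc p.2.1 = v₂ <;> simp [h1, h2, h3, h4]
  have hfac : ∀ (α : Fin k) (v : Fin t → Fin 5), ∑ b : Blk np k,
      (if b.2 = α then (1 : ℝ) else 0) * (if codev5 pc b.1 = v then w b.1 / k else 0) = (∏ i, g₅ a₁ a₂ (v i)) / k := by
    intro α v
    rw [Fintype.sum_prod_type, ← hm', sum_div]
    dsimp only
    refine sum_congr rfl fun σ _ => ?_
    have e : ∀ y : Fin k, (if y = α then (1 : ℝ) else 0) * (if codev5 pc σ = v then w σ / k else 0) =
        if y = α then (if codev5 pc σ = v then w σ / k else 0) else 0 := fun y => by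
      split_ifs <;> simp
    simp_rw [e]
    rw [sum_ite_eq']
    simp only [mem_univ, if_true]
    split_ifs <;> simp
  calc ∑ p : Blk np k × Blk np k, (if Φ5 pc p = ℓ then νw k w p.1 * νw k w p.2 else 0)
      = ∑ p : Blk np k × Blk np k, F₁ p.1 * F₂ p.2 := sum_congr rfl fun p _ => hterm p
    _ = ∑ b : Blk np k, ∑ b' : Blk np k, F₁ b * F₂ b' := Fintype.sum_prod_type _
    _ = (∑ b : Blk np k, F₁ b) * ∑ b' : Blk np k, F₂ b' := (sum_mul_sum _ _ _ _).symm
    _ = (∏ i, g₅ a₁ a₂ (v₁ i)) / k * ((∏ i, g₅ a₁ a₂ (v₂ i)) / k) := by rw [hF₁, hF₂, hfac, hfac]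
    _ = (1 : ℝ) / (k : ℝ) ^ 2 * ∏ i, (g₅ a₁ a₂ (ℓ.2 i).1 * g₅ a₁ a₂ (ℓ.2 i).2) := by
        rw [prod_mul_distrib]
        simp only [hv₁, hv₂]
        field_simp

/-- **The product formula** for the block transition sums (five letters). -/
theorem Pn_eq5 {pc : Fin np → List (Fin t × Bool)} {w : Fin np → ℝ} {a₁ a₂ : ℝ} (hc : Cube2 pc)
    (hm : Marg5 pc w a₁ a₂) (hk : 0 < k) (n : ℕ) (τ τ' : Fin k → ℤ) (y y' : Fin t → ℤ) :
    Pn pc (νw k w) n (τ, y) (τ', y') =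
      cnt k n (τ - τ') / (k : ℝ) ^ (2 * n) * ∏ i, H a₁ a₂ (2 * n) (y' i - y i) := by
  -- Step 1: words of pairs; the final offset is the sum of the letter increments
  have h1 : Pn pc (νw k w) n (τ, y) (τ', y') = ∑ ξ : Fin n → Blk np k × Blk np k,
      (∏ j, (νw k w (ξ j).1 * νw k w (ξ j).2)) *
        (if (τ, y) + ∑ j, Dℓ5 (Φ5 pc (ξ j)) = (τ', y') then (1 : ℝ) else 0) := by
    unfold Pn
    rw [sum_pair_eq (fun β β' : Fin n → Blk np k =>
      wt' (νw k w) β * wt' (νw k w) β' * if offAt pc (τ, y) β β' n = (τ', y') then (1 : ℝ) else 0)]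
    refine sum_congr rfl fun ξ _ => ?_
    rw [wt', wt', ← prod_mul_distrib]
    unfold offAt
    simp only [Fin.is_lt, if_true, δ_eq_Dℓ5 hc]
  -- Step 2: push forward along `Φ5`, fibre weights by `fibre_Φ5`
  have h2 := sum_prod_comp (Φ5 pc) (fun p : Blk np k × Blk np k => νw k w p.1 * νw k w p.2) n
    (fun η => if (τ, y) + ∑ j, Dℓ5 (η j) = (τ', y') then (1 : ℝ) else 0)
  simp only [Function.comp_def, fibre_Φ5 hm hk] at h2
  rw [h1, h2]
  -- Step 3: split the indicator and factorise time / transverse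
  have hind : ∀ η : Fin n → (Fin k × Fin k) × (Fin t → Fin 5 × Fin 5),
      (if (τ, y) + ∑ j, Dℓ5 (η j) = (τ', y') then (1 : ℝ) else 0) =
        (if τ + ∑ j, (e (η j).1.2 - e (η j).1.1) = τ' then (1 : ℝ) else 0) *
          (if y + ∑ j, (fun i => val5 ((η j).2 i).2 - val5 ((η j).2 i).1) = y' then (1 : ℝ) else 0) := by
    intro η
    rw [ite_zero_mul_ite_zero, one_mul]
    refine if_congr ?_ rfl rfl
    rw [Prod.ext_iff, Prod.fst_add, Prod.snd_add, Prod.fst_sum, Prod.snd_sum]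
    rfl
  simp_rw [hind]
  have h3 := sum_prod_mul_factor (n := n) (fun _ : Fin k × Fin k => (1 : ℝ) / (k : ℝ) ^ 2)
    (fun m : Fin t → Fin 5 × Fin 5 => ∏ i, (g₅ a₁ a₂ (m i).1 * g₅ a₁ a₂ (m i).2))
    (fun α => if τ + ∑ j, (e (α j).2 - e (α j).1) = τ' then (1 : ℝ) else 0)
    (fun ζ => if y + ∑ j, (fun i => val5 ((ζ j) i).2 - val5 ((ζ j) i).1) = y' then (1 : ℝ) else 0)
  simp only at h3
  rw [h3, time_sum_eq_cnt hk]
  congr 1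
  -- Step 4: the transverse factor, coordinate by coordinate
  have hvec : ∀ ζ : Fin n → (Fin t → Fin 5 × Fin 5),
      (if y + ∑ j, (fun i => val5 ((ζ j) i).2 - val5 ((ζ j) i).1) = y' then (1 : ℝ) else 0) =
        ∏ i, (if y i + ∑ j, (val5 ((ζ j) i).2 - val5 ((ζ j) i).1) = y' i then (1 : ℝ) else 0) := by
    intro ζ
    have hiff : (y + ∑ j, (fun i => val5 ((ζ j) i).2 - val5 ((ζ j) i).1) = y') ↔
        ∀ i, y i + ∑ j, (val5 ((ζ j) i).2 - val5 ((ζ j) i).1) = y' i := by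
      rw [funext_iff]
      refine forall_congr' fun i => ?_
      rw [Pi.add_apply, Finset.sum_apply]
    by_cases hV : y + ∑ j, (fun i => val5 ((ζ j) i).2 - val5 ((ζ j) i).1) = y'
    · rw [if_pos hV]; exact (prod_eq_one fun i _ => if_pos ((hiff.1 hV) i)).symm
    · rw [if_neg hV]
      obtain ⟨i, hi⟩ := not_forall.1 (mt hiff.2 hV)
      exact (prod_eq_zero (mem_univ i) (if_neg hi)).symm
  simp_rw [hvec]
  rw [sum_prod_pi_factor t n (fun c : Fin 5 × Fin 5 => g₅ a₁ a₂ c.1 * g₅ a₁ a₂ c.2)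
    (fun i ζ => if y i + ∑ j, (val5 (ζ j).2 - val5 (ζ j).1) = y' i then (1 : ℝ) else 0)]
  refine prod_congr rfl fun i _ => ?_
  rw [← Apair5_eq_H, Apair5]
  refine sum_congr rfl fun ζ _ => ?_
  congr 1
  refine if_congr ?_ rfl rfl
  constructor <;> intro h <;> linarith

/-! ### Partial Green sums towards time offset zero -/

/-- **The diagonal class**: `Gm m (0,u) (0,z) = Σ_{i<m} u k i · Π_l H (2i) (z l - u l)`. -/
theorem Gm_zero_eq5 {pc : Fin np → List (Fin t × Bool)} {w : Fin np → ℝ} {a₁ a₂ : ℝ} (hc : Cube2 pc)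
    (hm : Marg5 pc w a₁ a₂) (hk : 0 < k) (m : ℕ) (x z : Fin t → ℤ) :
    Gm pc (νw k w) m (0, x) (0, z) = ∑ i ∈ range m, u k i * ∏ l, H a₁ a₂ (2 * i) (z l - x l) := by
  unfold Gm
  refine sum_congr rfl fun i _ => ?_
  rw [Pn_eq5 hc hm hk, sub_zero, OSM.u]

/-- **The adjacent classes summed**:
`Σ_{a,a'} [a ≠ a'] Gm m (e a' - e a, u) (0,z) = Σ_{i<m} (k² u k (i+1) - k u k i) Π_l H (2i) (z l - u l)`. -/
theorem sum_Gm_adj_eq5 {pc : Fin np → List (Fin t × Bool)} {w : Fin np → ℝ} {a₁ a₂ : ℝ} (hc : Cube2 pc)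
    (hm : Marg5 pc w a₁ a₂) (hk : 0 < k) (m : ℕ) (x z : Fin t → ℤ) :
    ∑ a : Fin k, ∑ a' : Fin k, (if a = a' then 0 else Gm pc (νw k w) m (e a' - e a, x) (0, z)) =
      ∑ i ∈ range m, ((k : ℝ) ^ 2 * u k (i + 1) - k * u k i) * ∏ l, H a₁ a₂ (2 * i) (z l - x l) := by
  have hk0 : (0 : ℝ) < k := by exact_mod_cast hk
  unfold Gm
  simp_rw [Pn_eq5 hc hm hk, sub_zero]
  rw [show (∑ a : Fin k, ∑ a' : Fin k, if a = a' then (0 : ℝ) else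
      ∑ i ∈ range m, cnt k i (e a' - e a) / (k : ℝ) ^ (2 * i) * ∏ l, H a₁ a₂ (2 * i) (z l - x l)) =
      ∑ a : Fin k, ∑ a' : Fin k, ∑ i ∈ range m, (if a = a' then (0 : ℝ) else cnt k i (e a' - e a)) /
        (k : ℝ) ^ (2 * i) * ∏ l, H a₁ a₂ (2 * i) (z l - x l) from
    sum_congr rfl fun a _ => sum_congr rfl fun a' _ => by split_ifs <;> simp]
  rw [← Fintype.sum_prod_type', sum_comm]
  refine sum_congr rfl fun i _ => ?_
  rw [Fintype.sum_prod_type]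
  dsimp only
  simp_rw [← sum_mul, ← sum_div]
  rw [sum_cnt_adj i, OSM.u, OSM.u]
  have hk2 : (k : ℝ) ^ (2 * (i + 1)) = (k : ℝ) ^ (2 * i) * (k : ℝ) ^ 2 := by ring
  rw [hk2]
  field_simp

end Summit.CriticalPhenomena.PercolationContinuityZ3.Theorems.Pcint.BSMX

end
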